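import Summits.KontsevichZagierPeriods.KontsevichZagierPeriods.Theorems.SoloInformedAlgTheorem2DAll
import HarnessLib

/-!
# THEOREM 2D⁺, numeric form: rational period integrals over the square

Solo programme `solo-KontsevichZagierPeriods-informed`, session s108 (addendum to THEOREM 2D⁺).

By the soundness of the KZ calculus (`KZ.relations_le_ker_eval_holds`, Literature) the
presentability statement THEOREM 2D⁺ (`soloInformed_presentable_rational_dim2_all`) evaluates to an
identity of real numbers:

**THEOREM 2D⁺ (numeric).**  For all `P, Q ∈ 𝔸_ℝ[x₀, x₁]` (real algebraic coefficients) such that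
the quotient `P/Q` is absolutely integrable on the open unit square, there are `k ≥ 1`, integers
`cⱼ` and cube germs `Gⱼ` (holomorphic near `[0,1]^{dⱼ}`, real on real points, algebraic over
`ℚ(z)`) with

  `k · ∫_{(0,1)²} P/Q dx = ∑ⱼ cⱼ · ∫_{[0,1]^{dⱼ}} Re Gⱼ(x) dx`

(`soloInformed_integral_rational_dim2_eq_sum`).  This is the kernel rung `n = 2` of the cube crux
of the programme in closed numeric form, with no hypothesis on the denominator beyond convergence.

References: Kontsevich–Zagier 2001 §1.1–1.2; Huber–Müller-Stach 2017 §13.1.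
-/

noncomputable section

open scoped BigOperators
open MeasureTheory Set
open Literature.NumberTheory.Transcendental Literature.NumberTheory.Transcendental.KZ

namespace Summit.KontsevichZagierPeriods.KontsevichZagierPeriods.Theorems

/-- Evaluation of a presentability relation: `k · value r = ∑ⱼ cⱼ · ∫_{cube} Re Gⱼ`. [this work] -/
theorem soloInformed_value_eq_sum_of_presentable {n : ℕ} {r : IntegralRep n}
    (h : of r ∈ soloInformedPresentable) :
    ∃ (k : ℕ) (_ : k ≠ 0) (m' : ℕ) (d : Fin m' → ℕ) (G : ∀ j, SoloInformedCubeGerm (d j))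
      (c : Fin m' → ℤ),
      (k : ℝ) * r.value =
        ∑ j, (c j : ℝ) * ∫ x in soloInformedCube (d j), ((G j).g (soloInformedToC (d j) x)).re := by
  obtain ⟨k, hk, m', d, G, c, ρ, hρd, hρi, hrel⟩ := soloInformed_exists_fin_of_presentable h
  refine ⟨k, hk, m', d, G, c, ?_⟩
  have h0 : eval (k • of r - ∑ j, c j • of (ρ j)) = 0 :=
    (AddMonoidHom.mem_ker (f := eval)).1 (relations_le_ker_eval_holds hrel)
  have hρ_val : ∀ j, (ρ j).value =
      ∫ x in soloInformedCube (d j), ((G j).g (soloInformedToC (d j) x)).re := fun j => by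
    have h := hρi j
    rw [← hρd j] at h
    rw [IntegralRep.value, setIntegral_congr_fun (IntegralRep.measurableSet_domain_holds (ρ j)) h,
      hρd j]
  rw [map_sub, sub_eq_zero, map_nsmul, map_sum, eval_of] at h0
  simp only [map_zsmul, eval_of, zsmul_eq_mul, nsmul_eq_mul, hρ_val] at h0
  exact h0

/-- **THEOREM 2D⁺ (numeric form).**  Every absolutely convergent integral over the open unit
square of a quotient of bivariate polynomials with real algebraic coefficients is, up to a positive
integer factor, an integral combination of integrals over unit cubes of real parts of cube germs.
[this work] -/
theorem soloInformed_integral_rational_dim2_eq_sum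
    (P Q : MvPolynomial (Fin 2) (algebraicClosure ℚ ℝ))
    (hint : IntegrableOn (fun x => (MvPolynomial.aeval x P : ℝ) / MvPolynomial.aeval x Q)
      (soloInformedOpenCube 2)) :
    ∃ (k : ℕ) (_ : k ≠ 0) (m' : ℕ) (d : Fin m' → ℕ) (G : ∀ j, SoloInformedCubeGerm (d j))
      (c : Fin m' → ℤ),
      (k : ℝ) * ∫ x in soloInformedOpenCube 2, (MvPolynomial.aeval x P : ℝ) / MvPolynomial.aeval x Q =
        ∑ j, (c j : ℝ) * ∫ x in soloInformedCube (d j), ((G j).g (soloInformedToC (d j) x)).re := by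
  set r := soloInformedOfRationalK₀ soloInformed_algCoeff_algebraicClosure (soloInformedOpenCube 2)
    P Q (isSemialgebraic_soloInformedOpenCube 2) hint with hr
  have hpres : of r ∈ soloInformedPresentable :=
    soloInformed_presentable_rational_dim2_all P Q r subset_rfl (soloInformedOpenCube_subset_cube 2)
      fun x _ => rfl
  have hval : r.value =
      ∫ x in soloInformedOpenCube 2, (MvPolynomial.aeval x P : ℝ) / MvPolynomial.aeval x Q := rfl
  rw [← hval]
  exact soloInformed_value_eq_sum_of_presentable hpres

/-- **The cube crux `n = 2`, numeric form on the closed square.**  For every `IntegralRep` `r` on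
`[0,1]²` with integrand `P/Q` on the open square (`P, Q ∈ 𝔸_ℝ[x₀, x₁]`):
`k · value r = ∑ⱼ cⱼ · ∫_{cube} Re Gⱼ` with `k ≥ 1`. [this work] -/
theorem soloInformed_value_rational_dim2_eq_sum (P Q : MvPolynomial (Fin 2) (algebraicClosure ℚ ℝ))
    (r : IntegralRep 2) (hr₁ : soloInformedOpenCube 2 ⊆ r.domain) (hr₂ : r.domain ⊆ soloInformedCube 2)
    (hri : EqOn r.integrand
      (fun x => (MvPolynomial.aeval x P : ℝ) / MvPolynomial.aeval x Q) (soloInformedOpenCube 2)) :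
    ∃ (k : ℕ) (_ : k ≠ 0) (m' : ℕ) (d : Fin m' → ℕ) (G : ∀ j, SoloInformedCubeGerm (d j))
      (c : Fin m' → ℤ),
      (k : ℝ) * r.value =
        ∑ j, (c j : ℝ) * ∫ x in soloInformedCube (d j), ((G j).g (soloInformedToC (d j) x)).re :=
  soloInformed_value_eq_sum_of_presentable
    (soloInformed_presentable_rational_dim2_all P Q r hr₁ hr₂ hri)

end Summit.KontsevichZagierPeriods.KontsevichZagierPeriods.Theorems
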